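import Literature.InformationTheory.QuantumCodes.ClusterCountingBound
import Literature.InformationTheory.QuantumCodes.MinWeightDecodingClusters
import HarnessLib

/-!
# The counting-bound threshold theorem for LDPC codes under minimum-weight decoding (Kovalev–Pryadko 2013 Thm. 3, Gottesman 2014 Thm. 3)

Topic `Literature/InformationTheory/QuantumCodes`. Theorem-only file (no named fact, no sorry): the ASSEMBLY of
`MinWeightDecodingClusters.lean` (coding half: a decoding failure forces a dense connected cluster of the check
graph) and `ClusterCountingBound.lean` (probabilistic half: the union bound over dense connected clusters).

**Printed statements.** Kovalev–Pryadko 2013, Thm. 3: for an infinite family of `(j,ℓ)`-limited LDPC codes,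
quantum or classical, with distance growing as a power (or logarithm) of `n`, "asymptotically certain recovery is
possible" for depolarizing / bit-flip probabilities below an explicit `p₁` (counting connected "violating
`(s,m)`-sets"). Gottesman 2014, Thm. 3: for a family of quantum `(r,c)`-LDPC codes `[[n_i,k_i,d_i]]` with
`d_i → ∞` under local stochastic noise with `p < p₀ = (2ze)⁻²`, `z = (r-1)c`, minimum-weight decoding has logical
error rate `≤ (n_i/ze)(2ze√p)^{d_i}/(1 - 2ze√p) → 0`.

**What is proved here** (`sum_decodingFails_le`): the finite-`n` failure bound for ONE ERROR TYPE of a CSS code —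
check matrix `H : Matrix (Fin m) (Fin n) (ZMod 2)`, trivial-error subspace `SX` (e.g. `rowSpaceOf HX`), any `d ≥ 1`
below the relevant distance (`d ≤ ‖x‖` for all `x ∈ ker H ∖ SX`), check graph of degree `≤ Δ` (`Δ ≥ 1`; for row
weight `≤ w` and column weight `≤ c`, `Δ = c(w-1)` works by `degree_checkGraph_le`), ANY minimum-weight decoder `D`
(`IsMinWeightDecoder`), and ANY locally stochastic weight `μ` of parameter `p ∈ [0,1]` (`IsLocallyStochastic`; the
i.i.d. `bernoulliWeight p` is one) with `r := 2Δ²√p < 1`: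

  `∑_{E : decoding of the error set E fails} μ E ≤ n · r^d / (Δ² (1 - r))`.

The constant is the tree's (`Δ^{2(s-1)}` connected sets through a vertex, `LatticeAnimalsGraph`) instead of the
printed lattice-animal constant `(ze)^{s-1}`; the threshold it yields is `p₀ = (2Δ²)⁻²` instead of `(2ze)⁻²` — same
form, weaker number, as flagged in both companion files. Along a family with `d → ∞` and `n = e^{o(d)}` the right
side tends to `0` for every fixed `p < p₀`: this is the printed "threshold" conclusion, whose packaging
(`HasThreshold`, code families, both error types, depolarizing noise) belongs to `Summits/Ventures/QEC/Thresholds`.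

## References

* [KovalevPryadko2013] A. A. Kovalev, L. P. Pryadko, Phys. Rev. A 87 (2013) 020304(R), arXiv:1208.2317, Thm. 3.
* [Gottesman2014] D. Gottesman, Quantum Inf. Comput. 14 (2014) 1338, arXiv:1310.2984, §4 Thm. 3.
-/

open Finset Matrix

namespace Literature.InformationTheory.QuantumCodes

open Literature.Probability.LatticeModels

variable {m n : ℕ}

/-- The error VECTOR of an error SET `E ⊆ Fin n` (indicator over `𝔽₂`). [folklore] -/
def errorVec (E : Finset (Fin n)) : Fin n → ZMod 2 := fun i => if i ∈ E then 1 else 0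

/-- The support of the error vector of `E` is `E`. [folklore] -/
private theorem supp_errorVec (E : Finset (Fin n)) : supp (errorVec E) = E := by
  ext i
  simp only [supp, errorVec, Finset.mem_filter, Finset.mem_univ, true_and]
  by_cases hi : i ∈ E
  · simp [hi]
  · simp [hi]

/-- `D` is a **minimum-weight decoder** for the check matrix `H`: on every syndrome `H e` it returns a vector with
that syndrome and of least Hamming weight among all such vectors ("choose the lowest-weight error consistent with the
error syndrome. If there is more than one, choose one" — Gottesman 2014, proof of Thm. 3; Kovalev–Pryadko 2013 Thm. 3
"corresponds to maximum-likelihood decoding" in their terminology). [cite: Gottesman2014, Thm 3 (proof: the decoding algorithm)] -/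
def IsMinWeightDecoder (H : Matrix (Fin m) (Fin n) (ZMod 2)) (D : (Fin m → ZMod 2) → (Fin n → ZMod 2)) : Prop :=
  ∀ e : Fin n → ZMod 2, H *ᵥ D (H *ᵥ e) = H *ᵥ e ∧
    ∀ x : Fin n → ZMod 2, H *ᵥ x = H *ᵥ e → hammingNorm (D (H *ᵥ e)) ≤ hammingNorm x

/-- **Decoding failure** of the error set `E` for decoder `D`, check matrix `H` and trivial-error subspace `SX`: the
residual error `e + D(H e)` is a non-trivial logical operator, `∉ SX` (for a classical code, `SX = ⊥`: `D(H e) ≠ e`).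
[cite: Gottesman2014, Thm 3 (proof: "logical error after decoding")] -/
def DecodingFails (H : Matrix (Fin m) (Fin n) (ZMod 2)) (SX : Submodule (ZMod 2) (Fin n → ZMod 2))
    (D : (Fin m → ZMod 2) → (Fin n → ZMod 2)) (E : Finset (Fin n)) : Prop :=
  errorVec E + D (H *ᵥ errorVec E) ∉ SX

/-- A failing error set carries a dense connected cluster of the check graph (`MinWeightDecodingClusters.lean`,
restated on error SETS). [cite: Gottesman2014, Thm 3 (proof, first claim)] -/
theorem hasDenseCluster_of_decodingFails (H : Matrix (Fin m) (Fin n) (ZMod 2))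
    (SX : Submodule (ZMod 2) (Fin n → ZMod 2)) {D : (Fin m → ZMod 2) → (Fin n → ZMod 2)}
    (hD : IsMinWeightDecoder H D) {d : ℕ} (hd : ∀ x : Fin n → ZMod 2, H *ᵥ x = 0 → x ∉ SX → d ≤ hammingNorm x)
    {E : Finset (Fin n)} (hE : DecodingFails H SX D E) : HasDenseCluster (checkGraph H) d E := by
  obtain ⟨S, hS⟩ := exists_denseCluster_of_minWeight_failure H SX hd (hD (errorVec E)).1 (hD (errorVec E)).2 hE
  rw [supp_errorVec] at hS
  exact ⟨S, hS⟩

/-- **Counting-bound threshold theorem, finite-length form** (Kovalev–Pryadko 2013 Thm. 3 / Gottesman 2014 Thm. 3 for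
one error type of a CSS code, with the tree's animal constant). Check matrix `H`, trivial errors `SX`, `1 ≤ d` with
`d ≤ ‖x‖` for every `x ∈ ker H ∖ SX`, check graph of maximal degree `≤ Δ` with `1 ≤ Δ`, a minimum-weight decoder `D`,
a locally stochastic error weight `μ` of parameter `p ∈ [0,1]`, and `r := 2Δ²√p < 1`. Then the total weight of the
failing error sets is at most `n · r^d / (Δ²(1 - r))` — exponentially small in the distance, linear in the length:
Gottesman's "`n_i (p/p₀)^{d_i/2}`" with `p₀ = (2Δ²)⁻²`. [cite: Gottesman2014, Thm 3] -/
theorem sum_decodingFails_le (H : Matrix (Fin m) (Fin n) (ZMod 2)) (SX : Submodule (ZMod 2) (Fin n → ZMod 2))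
    {D : (Fin m → ZMod 2) → (Fin n → ZMod 2)} (hD : IsMinWeightDecoder H D) [DecidablePred (DecodingFails H SX D)]
    {d : ℕ} (hd1 : 1 ≤ d) (hd : ∀ x : Fin n → ZMod 2, H *ᵥ x = 0 → x ∉ SX → d ≤ hammingNorm x)
    {Δ : ℕ} (hΔ1 : 1 ≤ Δ) [DecidableRel (checkGraph H).Adj] (hΔ : ∀ v, (checkGraph H).degree v ≤ Δ)
    {μ : Finset (Fin n) → ℝ} {p : ℝ} (hμ : IsLocallyStochastic μ p) (hp0 : 0 ≤ p) (hp1 : p ≤ 1)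
    (hr : 2 * (Δ : ℝ) ^ 2 * Real.sqrt p < 1) :
    ∑ E ∈ univ.filter (fun E => DecodingFails H SX D E), μ E ≤
      (n : ℝ) * (2 * (Δ : ℝ) ^ 2 * Real.sqrt p) ^ d / ((Δ : ℝ) ^ 2 * (1 - 2 * (Δ : ℝ) ^ 2 * Real.sqrt p)) := by
  classical
  have hsub : univ.filter (fun E => DecodingFails H SX D E) ⊆
      univ.filter (fun E => HasDenseCluster (checkGraph H) d E) := by
    intro E hE
    rw [Finset.mem_filter] at hE ⊢
    exact ⟨hE.1, hasDenseCluster_of_decodingFails H SX hD hd hE.2⟩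
  have h1 : ∑ E ∈ univ.filter (fun E => DecodingFails H SX D E), μ E ≤
      ∑ E ∈ univ.filter (fun E => HasDenseCluster (checkGraph H) d E), μ E :=
    Finset.sum_le_sum_of_subset_of_nonneg hsub fun E _ _ => hμ.nonneg E
  have h2 := sum_hasDenseCluster_le_geometric (G := checkGraph H) hΔ hΔ1 hμ hp0 hp1 hd1 hr
  rw [Fintype.card_fin] at h2
  exact h1.trans h2

/-- The same bound for the **i.i.d. model**: each position faulty independently with probability `p`
(`bernoulliWeight`), e.g. independent `X`-errors on a CSS code (Kovalev–Pryadko 2013 Thm. 3's channel).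
[cite: KovalevPryadko2013, Thm 3] -/
theorem sum_decodingFails_bernoulli_le (H : Matrix (Fin m) (Fin n) (ZMod 2))
    (SX : Submodule (ZMod 2) (Fin n → ZMod 2)) {D : (Fin m → ZMod 2) → (Fin n → ZMod 2)}
    (hD : IsMinWeightDecoder H D) [DecidablePred (DecodingFails H SX D)] {d : ℕ} (hd1 : 1 ≤ d)
    (hd : ∀ x : Fin n → ZMod 2, H *ᵥ x = 0 → x ∉ SX → d ≤ hammingNorm x) {Δ : ℕ} (hΔ1 : 1 ≤ Δ)
    [DecidableRel (checkGraph H).Adj] (hΔ : ∀ v, (checkGraph H).degree v ≤ Δ) {p : ℝ} (hp0 : 0 ≤ p)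
    (hp1 : p ≤ 1) (hr : 2 * (Δ : ℝ) ^ 2 * Real.sqrt p < 1) :
    ∑ E ∈ univ.filter (fun E => DecodingFails H SX D E), bernoulliWeight p E ≤
      (n : ℝ) * (2 * (Δ : ℝ) ^ 2 * Real.sqrt p) ^ d / ((Δ : ℝ) ^ 2 * (1 - 2 * (Δ : ℝ) ^ 2 * Real.sqrt p)) :=
  sum_decodingFails_le H SX hD hd1 hd hΔ1 hΔ (isLocallyStochastic_bernoulliWeight hp0 hp1) hp0 hp1 hr

end Literature.InformationTheory.QuantumCodes
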